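import Summits.ValiantsHypothesis.ValiantsHypothesis.Theorems.AnyonJetsConstantFreeJetGrowthDefs
import Literature.Computability.AlgebraicComplexity.ArithCircuit
import Mathlib.FieldTheory.IsAlgClosed.AlgebraicClosure
import Mathlib.NumberTheory.Padics.PadicVal.Defs
import Mathlib.Analysis.Complex.Basic
import HarnessLib

/-!
# Route AnyonJets — crux `JetConstantElim` (stmt-ValiantsHypothesis-16737), line `birth`: objects of
# the MULTIPLIER BYPASS (the "ultimate" = up-to-an-integer-multiplier variants)

Definitions file (vocabulary only — PREDICATES in the exponents; no statement is asserted, the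
route-level `∃`-statements are for the planner to file) for the re-glue of route `AnyonJets`
that takes `stub_multiplierRemoval` off the critical path (helper files
`AnyonJetsJetConstantElimMultiplierBypass*.lean`, where the same statements appear INLINE and are
proved to compose). Naming follows Bürgisser 2009, §1 ("ultimately easy" = easy up to an integer
multiplier). With `J_(n,k) = jet n k` (the `k`-th anyonic jet), `τ = constantFreeComplexity`,
`L = complexity` over `ℂ`, `v₂ = padicValNat 2`:

* `CFUltAt c k` (`CF^ult := ∀ c ∃ k ≥ 1, CFUltAt c k`) — MULTIPLIER-ROBUST constant-free jet growth: for every `c`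
  some fixed `k ≥ 1` has, infinitely often in `n`, `τ(M·J_(n,k)) ≥ n^c` for EVERY multiplier `M ≥ 1`
  of 2-adic valuation `v₂(M) ≤ n^c`. Implied by the route's Boolean far side `PerModPowBooleanHard`
  (`cfUltimate_of_perModPowBooleanHard`: a multiplier dissolves in the Boolean shadow — odd part
  inverted modulo `2^{k+e}`, 2-part shifts bits); implies `ConstantFreeJetGrowth` (`M = 1`).
* `CEUltWith b` (`CE^ult := ∃ b, CEUltWith b`) / `CEUltTwoAdicWith b` (`CE^ult₂ := ∃ b, …`) — CONSTANT
  ELIMINATION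
  UP TO A MULTIPLIER: one exponent `b` such that every jet `J_(n,k)`, `k ≤ log₂ n`, has a multiple
  `M·J_(n,k)`, `M ≥ 1`, with `τ(M·J_(n,k)) ≤ (L(J_(n,k)) + n + 2)^b` and `log₂ M ≤ (L + n + 2)^b`
  (resp., sharp form, only `v₂(M) ≤ (L + n + 2)^b`). Follows from `stub_algebraicDescent`,
  `stub_signSimulation` (both landed) and `IntegralMultipleTwoAdic` WITHOUT multiplier removal
  (`jetConstantElimUltimateTwoAdic_of`); with `CF^ult` and `UniformJetUpperBound` it gives `VH`
  (`closes_ultimate_twoAdic`).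
* `IntegralMultipleTwoAdicWith b₁` (`stub_integralMultiple₂ := ∃ b₁, …`) — the registered stub `stub_integralMultiple`
  of the line (from a fan-in-two `ℚ̄`-circuit `Q` for `J_(n,k)`: an integer fan-in-two circuit `P`
  with constants and sum coefficients of absolute value `≤ 2^t` computing some multiple
  `M·J_(n,k)`, `|P| + t + 2 ≤ (|Q| + n + 2)^{b₁}`) with the ONE extra conjunct
  `v₂(M) ≤ (|Q| + n + 2)^{b₁}` ("no deep towers of the constant `1/2`"). Conjecture-grade, as the
  registered stub (field of definition / height of near-optimal circuits; Koiran–Perifel 2011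
  Rem. 4, Bürgisser 2000 Ch. 4); the extra conjunct is automatic when the common denominator of
  the constants is odd (algebraic-integer constants give `M = 1`) and NOT automatic under exponent
  balancing with towers of `1/2` (`M = N^e`, `e ≤ 2^{|Q|}`) — the honest residual of
  `stub_multiplierRemoval`.

Honest framing: vocabulary only; every statement named here is OPEN except the implications proved
in the bypass files; nothing here bears on VP ≠ VNP.

References: P. Bürgisser, *On defining integers and proving arithmetic circuit lower bounds*,
Comput. Complexity 18 (2009), §1, Thm. 2.10; P. Koiran, S. Perifel, *Interpolation in Valiant's
theory*, Comput. Complexity 20 (2011), Rem. 4; P. Bürgisser, *Completeness and Reduction in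
Algebraic Complexity Theory*, Springer 2000, Ch. 4.
-/

set_option linter.dupNamespace false

namespace Summit.ValiantsHypothesis.ValiantsHypothesis.Theorems.AnyonJets.JetConstantElim

open scoped BigOperators
open Summit.ValiantsHypothesis.ValiantsHypothesis.Theorems.AnyonJets.ConstantFreeJetGrowth (jet)

noncomputable section

/-- **`CF^ult` at exponent `c` and order `k`** — the order-`k` jets witness MULTIPLIER-ROBUST
constant-free growth of exponent `c`: for infinitely many `n`, EVERY multiple `M·J_(n,k)` with
`M ≥ 1` and `v₂(M) ≤ n^c` has constant-free complexity `≥ n^c`. The route-level statement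
`CF^ult` is `∀ c, ∃ k ≥ 1, CFUltAt c k` (its `M = 1` case is the route's `ConstantFreeJetGrowth`).
Vocabulary of the bypass (Bürgisser 2009, §1 "ultimately"). [folklore] -/
def CFUltAt (c k : ℕ) : Prop :=
  ∀ n₀ : ℕ, ∃ n : ℕ, n₀ ≤ n ∧ ∀ M : ℕ, 1 ≤ M → padicValNat 2 M ≤ n ^ c →
    n ^ c ≤ Literature.Computability.AlgebraicComplexity.constantFreeComplexity ((M : ℤ) • jet n k)

/-- **`CE^ult` with exponent `b`** — constant elimination up to a multiplier of polynomial
BIT-LENGTH: for all `n` and all `k ≤ log₂ n` some multiple `M·J_(n,k)`, `M ≥ 1`,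
`log₂ M ≤ (L_ℂ(J_(n,k)) + n + 2)^b`, has `τ(M·J_(n,k)) ≤ (L_ℂ(J_(n,k)) + n + 2)^b`. The route-level
statement `CE^ult` is `∃ b, CEUltWith b`. Vocabulary of the bypass (Bürgisser 2009, §1). [folklore] -/
def CEUltWith (b : ℕ) : Prop :=
  ∀ n k : ℕ, k ≤ Nat.log 2 n → ∃ M : ℕ, 1 ≤ M ∧
    Nat.log 2 M ≤ (Literature.Computability.AlgebraicComplexity.complexity
      (MvPolynomial.map (Int.castRingHom ℂ) (jet n k)) + n + 2) ^ b ∧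
    Literature.Computability.AlgebraicComplexity.constantFreeComplexity ((M : ℤ) • jet n k) ≤
      (Literature.Computability.AlgebraicComplexity.complexity
        (MvPolynomial.map (Int.castRingHom ℂ) (jet n k)) + n + 2) ^ b

/-- **`CE^ult₂` with exponent `b`** — constant elimination up to a multiplier of polynomial
2-ADIC DEPTH (sharp form: the odd part of `M` is unrestricted): for all `n` and all `k ≤ log₂ n`
some multiple `M·J_(n,k)`, `M ≥ 1`, `v₂(M) ≤ (L_ℂ(J_(n,k)) + n + 2)^b`, has
`τ(M·J_(n,k)) ≤ (L_ℂ(J_(n,k)) + n + 2)^b`. The route-level statement `CE^ult₂` is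
`∃ b, CEUltTwoAdicWith b`. Vocabulary of the bypass (Bürgisser 2009, §1). [folklore] -/
def CEUltTwoAdicWith (b : ℕ) : Prop :=
  ∀ n k : ℕ, k ≤ Nat.log 2 n → ∃ M : ℕ, 1 ≤ M ∧
    padicValNat 2 M ≤ (Literature.Computability.AlgebraicComplexity.complexity
      (MvPolynomial.map (Int.castRingHom ℂ) (jet n k)) + n + 2) ^ b ∧
    Literature.Computability.AlgebraicComplexity.constantFreeComplexity ((M : ℤ) • jet n k) ≤
      (Literature.Computability.AlgebraicComplexity.complexity
        (MvPolynomial.map (Int.castRingHom ℂ) (jet n k)) + n + 2) ^ b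

/-- **`stub_integralMultiple₂` with exponent `b₁`** — the integral normal form of a multiple,
with 2-adic depth recorded: for `k ≤ log₂ n`, a fan-in-two `ℚ̄`-circuit `Q` computing `J_(n,k)`
yields an integer fan-in-two circuit `P`, a height `t` and a multiplier `M ≥ 1` with `P` computing
`M·J_(n,k)`, all constant operands, sum coefficients and the output constant of absolute value
`≤ 2^t`, `|P| + t + 2 ≤ (|Q|+n+2)^{b₁}` and `v₂(M) ≤ (|Q| + n + 2)^{b₁}` — the registered stub
`stub_integralMultiple` of line `birth` is `∃ b₁` of this WITHOUT the last conjunct (Koiran–Perifel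
2011, Rem. 4 names the question). Route-posited vocabulary, named so that the bypass theorems
and a re-glued `closes` can refer to it. [folklore] -/
def IntegralMultipleTwoAdicWith (b₁ : ℕ) : Prop :=
  ∀ n k : ℕ, k ≤ Nat.log 2 n →
    ∀ Q : Literature.Computability.AlgebraicComplexity.ArithCircuit (AlgebraicClosure ℚ) (Fin n × Fin n),
      Q.IsFanInTwo →
      Q.Computes (MvPolynomial.map (Int.castRingHom (AlgebraicClosure ℚ)) (jet n k)) →
      ∃ (P : Literature.Computability.AlgebraicComplexity.ArithCircuit ℤ (Fin n × Fin n)) (t M : ℕ),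
        1 ≤ M ∧ P.IsFanInTwo ∧ P.Computes ((M : ℤ) • jet n k) ∧
        ((∀ g ∈ P.gates, ∀ u ∈ g.args, ∀ c : ℤ, u = .const c → c.natAbs ≤ 2 ^ t) ∧
          (∀ args : List (ℤ × Literature.Computability.AlgebraicComplexity.ArithCircuit.Operand ℤ (Fin n × Fin n)),
            Literature.Computability.AlgebraicComplexity.ArithCircuit.Gate.sum args ∈ P.gates →
              ∀ a ∈ args, a.1.natAbs ≤ 2 ^ t) ∧
          (∀ c : ℤ, P.output = .const c → c.natAbs ≤ 2 ^ t)) ∧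
        P.size + t + 2 ≤ (Q.size + n + 2) ^ b₁ ∧ padicValNat 2 M ≤ (Q.size + n + 2) ^ b₁

end

end Summit.ValiantsHypothesis.ValiantsHypothesis.Theorems.AnyonJets.JetConstantElim
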